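import Summits.HubbardSuperconductivity.HubbardSuperconductivity.Theorems.NodalWardXYDefs

/-!
# `PerturbedXYOrder` (stmt-HubbardSuperconductivity-10739) — line `schwarz-inheritance`, stub `stub_stabilityOfTaylorBounds`

Cauchy–Taylor half of the lever: Gevrey bounds on Taylor coefficients at 0 ⇒ zero-freeness and plateau stability on ‖t‖ ≤ 1/(2A).

Everything here is one-variable complex analysis:
* `stab_zero_free` — an entire `Z` with `Z 0 = z₀ ≠ 0` whose logarithm `log (Z t / z₀)` has Taylor coefficients at `0`
  bounded by `Aⁿ V` has no zeros on the ball of radius `ρ`, `A ρ < 1` (the coefficient series `g` converges and is holomorphic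
  on that ball, `exp ∘ g = Z/z₀` near `0`, hence on the ball by the identity theorem);
* `stab_plateau` — a function holomorphic on a ball around `0` with Taylor coefficients bounded by `Aⁿ` moves by at most
  `Σ_{n ≥ 1} 2⁻ⁿ = 1` on `‖t‖ ≤ 1/(2A)` (Taylor series on the ball, `Complex.hasSum_taylorSeries_on_ball`).
-/

noncomputable section

namespace Summit.HubbardSuperconductivity.HubbardSuperconductivity.Theorems.PerturbedXYOrder

open MeasureTheory Literature.Probability.LatticeModels
open Summit.HubbardSuperconductivity.HubbardSuperconductivity.Theses.NodalWardXY
open scoped Topology Nat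

/-- Norm of a Taylor term `(n!)⁻¹ * d * w ^ n` in terms of `‖d‖` and `‖w‖`. [folklore] -/
theorem stab_norm_taylorTerm (n : ℕ) (d w : ℂ) :
    ‖(n ! : ℂ)⁻¹ * d * w ^ n‖ = (n ! : ℝ)⁻¹ * ‖d‖ * ‖w‖ ^ n := by
  rw [norm_mul, norm_mul, norm_inv, Complex.norm_natCast, norm_pow]

/-- A Taylor term with Gevrey-1 coefficient bound `‖d‖ ≤ n! Aⁿ V` is bounded by `V (A ρ)ⁿ` on `‖w‖ ≤ ρ`. [folklore] -/
theorem stab_taylorTerm_le {n : ℕ} {d w : ℂ} {A V ρ : ℝ} (hA : 0 ≤ A) (hV : 0 ≤ V) (hw : ‖w‖ ≤ ρ)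
    (hd : ‖d‖ ≤ (n ! : ℝ) * A ^ n * V) :
    ‖(n ! : ℂ)⁻¹ * d * w ^ n‖ ≤ V * (A * ρ) ^ n := by
  rw [stab_norm_taylorTerm]
  have hρ : 0 ≤ ρ := (norm_nonneg w).trans hw
  have hfac : (0 : ℝ) < n ! := by exact_mod_cast Nat.factorial_pos n
  calc (n ! : ℝ)⁻¹ * ‖d‖ * ‖w‖ ^ n
      ≤ (n ! : ℝ)⁻¹ * ((n ! : ℝ) * A ^ n * V) * ρ ^ n := by
        gcongr
    _ = V * (A * ρ) ^ n := by
        field_simp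
        ring

/-- **Zero-freeness from Gevrey bounds on the logarithm.** Let `Z` be entire with `Z 0 = z₀ ≠ 0`, and suppose the Taylor
coefficients at `0` of `t ↦ log (Z t / z₀)` satisfy `‖f⁽ⁿ⁾(0)‖ ≤ n! Aⁿ V` for `n ≥ 1`.  Then `Z` has no zero in the open
ball of radius `ρ` around `0` whenever `A ρ < 1`: the coefficient series `g` is holomorphic on that ball
(`Complex.differentiableOn_tsum_of_summable_norm`), `exp ∘ g = Z / z₀` near `0` (Taylor's theorem for the holomorphic
branch of the logarithm near `0`, `Complex.hasSum_taylorSeries_on_ball`), hence on the whole ball by the identity theorem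
(`AnalyticOnNhd.eqOn_of_preconnected_of_eventuallyEq`), and `exp` never vanishes. [folklore] -/
theorem stab_zero_free {Z : ℂ → ℂ} (hZ : Differentiable ℂ Z) {z₀ : ℂ} (hz₀ : z₀ ≠ 0) (hZ0 : Z 0 = z₀)
    {A V ρ : ℝ} (hA : 0 < A) (hV : 0 ≤ V) (hρ : 0 < ρ) (hAρ : A * ρ < 1)
    (hf : ∀ n : ℕ, 1 ≤ n →
      ‖iteratedDeriv n (fun t : ℂ => Complex.log (Z t / z₀)) 0‖ ≤ (n.factorial : ℝ) * A ^ n * V) :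
    ∀ t ∈ Metric.ball (0 : ℂ) ρ, Z t ≠ 0 := by
  set r : ℂ → ℂ := fun t => Z t / z₀ with hr_def
  set f : ℂ → ℂ := fun t => Complex.log (Z t / z₀) with hf_def
  have hr : Differentiable ℂ r := hZ.div_const z₀
  have hr0 : r 0 = 1 := by simp [hr_def, hZ0, hz₀]
  have hf0 : f 0 = 0 := by simp [hf_def, hZ0, hz₀]
  -- Step 1: near `0`, `r` stays in the slit plane.
  obtain ⟨δ, hδ, hδslit⟩ : ∃ δ > 0, ∀ s ∈ Metric.ball (0 : ℂ) δ, r s ∈ Complex.slitPlane := by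
    have h1 : ∀ᶠ s in 𝓝 (0 : ℂ), r s ∈ Complex.slitPlane :=
      hr.continuous.continuousAt.eventually_mem
        (Complex.isOpen_slitPlane.mem_nhds (by rw [hr0]; exact Complex.one_mem_slitPlane))
    exact Metric.eventually_nhds_iff_ball.mp h1
  -- Step 2: `f = log ∘ r` is holomorphic on that small ball.
  have hfd : DifferentiableOn ℂ f (Metric.ball 0 δ) := hr.differentiableOn.clog hδslit
  -- Step 3: the coefficient series `g w = ∑' n, F n w` is holomorphic on the ball of radius `ρ`.
  set F : ℕ → ℂ → ℂ := fun n w => (n ! : ℂ)⁻¹ * iteratedDeriv n f 0 * w ^ n with hF_def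
  have hF_diff : ∀ n, DifferentiableOn ℂ (F n) (Metric.ball 0 ρ) := fun n =>
    ((differentiable_const _).mul (differentiable_id.pow n)).differentiableOn
  have hu : Summable (fun n : ℕ => V * (A * ρ) ^ n) :=
    (summable_geometric_of_lt_one (by positivity) hAρ).mul_left V
  have hF_le : ∀ (n : ℕ) (w : ℂ), w ∈ Metric.ball (0 : ℂ) ρ → ‖F n w‖ ≤ V * (A * ρ) ^ n := by
    intro n w hw
    have hw' : ‖w‖ ≤ ρ := (mem_ball_zero_iff.mp hw).le
    rcases Nat.eq_zero_or_pos n with rfl | hn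
    · simp [hF_def, hf0, hV]
    · exact stab_taylorTerm_le hA.le hV hw' (hf n hn)
  have hg_diff : DifferentiableOn ℂ (fun w => ∑' n, F n w) (Metric.ball 0 ρ) :=
    Complex.differentiableOn_tsum_of_summable_norm hu hF_diff Metric.isOpen_ball hF_le
  -- Step 4: `exp ∘ g` and `r` are analytic on the ball and agree near `0`.
  have hh_an : AnalyticOnNhd ℂ (fun w => Complex.exp (∑' n, F n w)) (Metric.ball 0 ρ) :=
    hg_diff.cexp.analyticOnNhd Metric.isOpen_ball
  have hr_an : AnalyticOnNhd ℂ r (Metric.ball 0 ρ) :=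
    hr.differentiableOn.analyticOnNhd Metric.isOpen_ball
  have hev : (fun w => Complex.exp (∑' n, F n w)) =ᶠ[𝓝 0] r := by
    refine Filter.eventuallyEq_of_mem (Metric.ball_mem_nhds 0 hδ) (fun s hs => ?_)
    have hT := Complex.hasSum_taylorSeries_on_ball hfd hs
    have hT' : HasSum (fun n => F n s) (f s) := by
      have hfun : (fun n => F n s) = (fun n : ℕ => (n ! : ℂ)⁻¹ • (s - 0) ^ n • iteratedDeriv n f 0) := by
        funext n
        simp only [hF_def, smul_eq_mul, sub_zero]
        ring
      rw [hfun]
      exact hT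
    show Complex.exp (∑' n, F n s) = r s
    rw [hT'.tsum_eq, hf_def]
    exact Complex.exp_log (Complex.slitPlane_ne_zero (hδslit s hs))
  have heq : Set.EqOn (fun w => Complex.exp (∑' n, F n w)) r (Metric.ball 0 ρ) :=
    hh_an.eqOn_of_preconnected_of_eventuallyEq hr_an (convex_ball (0 : ℂ) ρ).isPreconnected
      (Metric.mem_ball_self hρ) hev
  -- Step 5: conclude.
  intro t ht hZt
  have h1 : r t = 0 := by simp [hr_def, hZt]
  have h2 := heq ht
  simp only [h1] at h2
  exact Complex.exp_ne_zero _ h2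

/-- **Plateau stability from Gevrey bounds.** If `c` is holomorphic on the ball of radius `ρ` around `0` and its Taylor
coefficients satisfy `‖c⁽ⁿ⁾(0)‖ ≤ n! Aⁿ` for `n ≥ 1`, then `‖c t − c 0‖ ≤ Σ_{n ≥ 1} (A‖t‖)ⁿ ≤ Σ_{n ≥ 1} 2⁻ⁿ = 1` for
`‖t‖ ≤ 1/(2A)`, `‖t‖ < ρ` (Taylor series on the ball, `Complex.hasSum_taylorSeries_on_ball`). [folklore] -/
theorem stab_plateau {c : ℂ → ℂ} {A ρ : ℝ} (hA : 0 < A) (hc : DifferentiableOn ℂ c (Metric.ball 0 ρ))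
    (hd : ∀ n : ℕ, 1 ≤ n → ‖iteratedDeriv n c 0‖ ≤ (n.factorial : ℝ) * A ^ n)
    {t : ℂ} (htρ : ‖t‖ < ρ) (ht : ‖t‖ ≤ 1 / (2 * A)) :
    ‖c t - c 0‖ ≤ 1 := by
  have ht_mem : t ∈ Metric.ball (0 : ℂ) ρ := mem_ball_zero_iff.mpr htρ
  have hsum := Complex.hasSum_taylorSeries_on_ball hc ht_mem
  simp only [sub_zero] at hsum
  have hsum1 := (hasSum_nat_add_iff' 1).mpr hsum
  simp only [Finset.sum_range_one, pow_zero, iteratedDeriv_zero, Nat.factorial_zero, Nat.cast_one, inv_one,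
    one_smul] at hsum1
  have hAt : A * ‖t‖ ≤ 1 / 2 := by
    calc A * ‖t‖ ≤ A * (1 / (2 * A)) := by gcongr
      _ = 1 / 2 := by field_simp
  have hAt0 : 0 ≤ A * ‖t‖ := by positivity
  refine hsum1.norm_le_of_bounded (hasSum_geometric_two' 1) (fun n => ?_)
  rw [norm_smul, norm_smul, norm_inv, Complex.norm_natCast, norm_pow]
  have h1 := hd (n + 1) (Nat.le_add_left 1 n)
  have hfac : (0 : ℝ) < (n + 1)! := by exact_mod_cast Nat.factorial_pos (n + 1)
  calc ((n + 1)! : ℝ)⁻¹ * (‖t‖ ^ (n + 1) * ‖iteratedDeriv (n + 1) c 0‖)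
      ≤ ((n + 1)! : ℝ)⁻¹ * (‖t‖ ^ (n + 1) * (((n + 1)! : ℝ) * A ^ (n + 1))) := by gcongr
    _ = (A * ‖t‖) ^ (n + 1) := by
        field_simp
        ring
    _ ≤ (1 / 2) ^ (n + 1) := by gcongr
    _ = 1 / 2 / 2 ^ n := by
        rw [pow_succ, div_pow, one_pow]
        ring

/-- **Stability from Taylor bounds.** If the Taylor coefficients at `t = 0` of `log(Z(tK)/Z(0))` are `≤ Aⁿ V` and those
of `cratio(tK)` are `≤ Aⁿ` (`n ≥ 1`), then for `‖t‖ ≤ 1/(2A)`: `Z(tK) ≠ 0` (the log-series `g` converges on `‖t‖ < 1/A`,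
`exp ∘ g = Z(tK)/Z(0)` near `0` hence on the ball by the identity theorem) and `‖cratio(tK) − cratio(0)‖ ≤ Σ_{n≥1} 2⁻ⁿ = 1`
(Taylor series of the holomorphic `cratio(tK)` on the ball, `Complex.taylorSeries_eq_on_ball'`). [folklore] -/
theorem stub_stabilityOfTaylorBounds :
    ∀ (J : ℝ) (L : ℕ) [NeZero L] (K : Bond L → Bond L → ℂ) (A V : ℝ), 0 < A → 0 ≤ V →
      Differentiable ℂ (fun t : ℂ => Zk J (t • K)) → Differentiable ℂ (fun t : ℂ => num J (t • K)) →
      Zk J (0 : Bond L → Bond L → ℂ) ≠ 0 →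
      (∀ n : ℕ, 1 ≤ n →
        ‖iteratedDeriv n (fun t : ℂ => Complex.log (Zk J (t • K) / Zk J (0 : Bond L → Bond L → ℂ))) 0‖ ≤
          (n.factorial : ℝ) * A ^ n * V) →
      (∀ n : ℕ, 1 ≤ n → ‖iteratedDeriv n (fun t : ℂ => cratio L J (t • K)) 0‖ ≤ (n.factorial : ℝ) * A ^ n) →
      ∀ t : ℂ, ‖t‖ ≤ 1 / (2 * A) → Zk J (t • K) ≠ 0 ∧ ‖cratio L J (t • K) - cratio L J 0‖ ≤ 1 := by
  intro J L _ K A V hA hV hZ hN hZ0 hf hc t ht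
  have h0K : (0 : ℂ) • K = 0 := zero_smul ℂ K
  -- work on the ball of radius `ρ = 3/(4A)`: `1/(2A) < ρ` and `A ρ = 3/4 < 1`
  have hρ : 0 < 3 / (4 * A) := by positivity
  have hAρ : A * (3 / (4 * A)) < 1 := by
    rw [mul_div_assoc', mul_comm A 3, mul_div_mul_right _ _ hA.ne']  -- A*3/(4*A) = 3/4
    norm_num
  have htρ : ‖t‖ < 3 / (4 * A) := by
    refine lt_of_le_of_lt ht ?_
    rw [div_lt_div_iff₀ (by positivity) (by positivity)]
    nlinarith
  have hzf : ∀ s ∈ Metric.ball (0 : ℂ) (3 / (4 * A)), Zk J (s • K) ≠ 0 :=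
    stab_zero_free (Z := fun s : ℂ => Zk J (s • K)) hZ hZ0 (by simp only [h0K]) hA hV hρ hAρ hf
  refine ⟨hzf t (mem_ball_zero_iff.mpr htρ), ?_⟩
  have hcd : DifferentiableOn ℂ (fun s : ℂ => cratio L J (s • K)) (Metric.ball 0 (3 / (4 * A))) := by
    unfold cratio
    exact (hN.differentiableOn.fun_div hZ.differentiableOn hzf).div_const _
  have key : ‖cratio L J (t • K) - cratio L J ((0 : ℂ) • K)‖ ≤ 1 := stab_plateau hA hcd hc htρ ht
  rwa [h0K] at key

end Summit.HubbardSuperconductivity.HubbardSuperconductivity.Theorems.PerturbedXYOrder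

end
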